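import Summits.CriticalPhenomena.PercolationContinuityZ3.Theorems.Transplant.BoxProdSkeletonConcInstances
import Summits.CriticalPhenomena.PercolationContinuityZ3.Theorems.Transplant.BoxProdZ2SkeletonConcRegression
import HarnessLib

/-!
# ONE NODE ⇒ the class map: the consequences of the node of record `SamePDropOfSkeletonConcLt`, collected (class map v5, `P4-GENERAL.md` §13.2)

builds on p205010 (kernel theorem, internal audit signed; external expert review pending) — nothing in this file uses p205010 (the near-one gluing
enters the node's intended PROOF, not these implications, which are tree theorems).
Status sentence (coordinator 2026-08-20T04:30Z): "θ(p_c) = 0 on ℤ^d, all d ≥ 2 — kernel-verified (Lean 4/Mathlib, standard axioms);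
internal adversarial audit SIGNED 2026-08-20 04:29Z; external expert review pending."

Lane `prim-bschramm`, seat `prim-bschramm-p4` (gen 5; PART C3 deliverable 'the list of graph classes where INPUT(G) is known', as ONE Lean statement),
helper file (`--supports stmt-CriticalPhenomena-4575`).  Twin of `skeletonNode_consequences` (p4/lead, for the older witness node) for the node of record
of design (D): **`skeletonConcNode_consequences`** — `SamePDropOfSkeletonConcLt` implies `θ(p_c) = 0` on
`H₃(ℤ)` · `H₃(ℤ) × ℤ` · `H_{2k+1}(ℤ)` (every `k ≥ 2`, every vertex) · `ℤ²` (regression) · `X □ H₃(ℤ)` · `X □ (H₃(ℤ) × ℤ)` · `X □ H_{2k+1}(ℤ)` (`k ≥ 2`) ·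
`X □ ℤ²` (regression against the closed p228654) — for every connected, locally finite, quasi-transitive `X` and every vertex.  Every input of the node
(`p_c < 1`, uniqueness at `p_c`, subcritical cylinders at `p_c`, the interface fields (μ)(ι)(κ)) is discharged in the tree for each family (files
`HeisenbergSkeletonConc`, `HeisenbergZSkeletonConc`, `HeisenbergKSkeletonConc`, `PlanarSkeletonConcBoxProd`, `BoxProdSkeletonConcInstances`,
`BoxProdZ2SkeletonConcRegression`, p5-g4's `Zd2SkeletonConc`).  Nothing is claimed about the node.
[cite: BenjaminiSchramm1996, Conj. 4] [cite: KozmaNitzan2024, §1 p. 2 (approach 1); §4 pp. 15–31]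
-/

noncomputable section

namespace Summit.CriticalPhenomena.PercolationContinuityZ3.Theorems.Transplant

open MeasureTheory Literature.Probability.Percolation Literature.Probability.LatticeModels SimpleGraph
open Literature.Geometry.MetricEmbeddings (cayleyGraph)
open Literature.Barriers.CriticalPhenomena (IsQuasiTransitive)
open HeisenbergZ

/-- **ONE NODE ⇒ the class map (v5).**  The node of record `SamePDropOfSkeletonConcLt` implies `θ(p_c) = 0` on `H₃(ℤ)`, `H₃(ℤ) × ℤ`, every
`H_{2k+1}(ℤ)` with `k ≥ 2` (every vertex), `ℤ²`, and on `X □ H₃(ℤ)`, `X □ (H₃(ℤ) × ℤ)`, `X □ H_{2k+1}(ℤ)` (`k ≥ 2`), `X □ ℤ²` for every connected,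
locally finite, quasi-transitive `X` (every vertex) — builds on p205010 (kernel theorem, internal audit signed; external expert review pending) only
inside the node's intended proof.  Conditional on the node alone. [cite: BenjaminiSchramm1996, Conj. 4] [cite: KozmaNitzan2024, §4 pp. 15–31] -/
theorem skeletonConcNode_consequences (hD : SamePDropOfSkeletonConcLt) :
    HeisenbergCriticalContinuity ∧ HeisenbergZCriticalContinuity ∧
      (∀ (k : ℕ), 2 ≤ k → ∀ x : HK k, theta (hkGraph k) x (criticalProbIOf (hkGraph k) x) = 0) ∧
      theta (zdGraph 2) (0 : Site 2) (criticalProbIOf (zdGraph 2) 0) = 0 ∧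
      (∀ {W : Type} [DecidableEq W] (X : SimpleGraph W) [X.LocallyFinite], X.Connected → IsQuasiTransitive X →
        (∀ v : W × (ℤ × ℤ × ℤ), theta (X □ cayleyGraph) v (criticalProbIOf (X □ cayleyGraph) v) = 0) ∧
        (∀ v : W × HZ, theta (X □ heisenbergZGraph) v (criticalProbIOf (X □ heisenbergZGraph) v) = 0) ∧
        (∀ (k : ℕ), 2 ≤ k → ∀ v : W × HK k, theta (X □ hkGraph k) v (criticalProbIOf (X □ hkGraph k) v) = 0) ∧
        (∀ v : W × Site 2, theta (X □ zdGraph 2) v (criticalProbIOf (X □ zdGraph 2) v) = 0)) :=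
  ⟨heisenbergCriticalContinuity_of_skeletonConcNode hD, heisenbergZCriticalContinuity_of_skeletonConcNode hD,
    fun _ hk x => heisenbergK_criticalContinuity_of_skeletonConcNode' hD hk x, zd2_criticalContinuity_of_skeletonConcNode hD,
    fun X _ hc hq => ⟨bsConj4_boxProdHeisenberg_of_skeletonConcNode hD X hc hq, bsConj4_boxProdHeisenbergZ_of_skeletonConcNode hD X hc hq,
      fun _ hk v => bsConj4_boxProdHeisenbergK_of_skeletonConcNode' hD hk X hc hq v, bsConj4_boxProdZ2_of_skeletonConcNode hD X hc hq⟩⟩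

end Summit.CriticalPhenomena.PercolationContinuityZ3.Theorems.Transplant

end
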